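import Summits.Langlands.Langlands.Theses.ParityBlindBianchi
import Literature.NumberTheory.Automorphic.BaseChangeCyclicCuspidal
import Literature.NumberTheory.Automorphic.BaseChangeStrongUnramified
import Literature.NumberTheory.Automorphic.BaseChangeStrongAllFinite
import Literature.NumberTheory.Automorphic.BaseChangeArchimedean
import Literature.NumberTheory.Automorphic.CuspidalRepGL2Exists

/-!
# Disproof of `QuadraticBaseChangeGL2` (crux stmt-Langlands-16812) — findings

Standing disprover's work file (cdisprove, cycle 1, 2026-08-17).  VERDICT SO FAR: **resists**; no
kill, and — §2 — no UNCONDITIONAL kill is possible in the present tree.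

The crux (route `ParityBlindBianchi`, also wanted by `RuelleTorsionArtinWeight`) is the conjunction
of four clauses, (a) cuspidal weak base change given one inert non-`η`-symmetric Satake parameter,
(b) weak ⇒ unramified strong lift + descent of unramifiedness at places unramified in `E/F`,
(c) the relation `t_{P,w} = t_{π,v}^{f(w|v)}` at EVERY finite `w` (ramified `v` allowed),
(d) archimedean parameters restrict.  Findings, each a kernel-checked theorem below unless marked:

* §1 `not_facts_of_not_quadraticBaseChangeGL2` — the crux is VERBATIM the `n = 2`, `[E:F] = 2`
  specialisation of the four vendored Literature facts `baseChange_cyclic_cuspidal`,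
  `ArthurClozel1989_strongLifting_unramified`, `…_allFinite`, `…_archimedean` (Arthur–Clozel 1989,
  Ch. 3 Thm 4.2 (a), Thm 5.1; Langlands 1980).  Hence `¬ crux` refutes that conjunction of printed
  theorems at `n = 2`: a refutation can only be VOCABULARY DRIFT of the datum model.
* §2 `exists_cuspidal_of_not_quadraticBaseChangeGL2` — REFUTATION BARRIER: every clause quantifies
  universally over `CuspidalAutomorphicRepData 2 _ _`, so `¬ crux` produces an inhabitant of that
  type, i.e. proves an instance of the (undischarged) inhabitation fact
  `nonempty_cuspidalAutomorphicRepData_two` (Gelbart 1975 Thm 7.11).  The tree constructs no cusp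
  form on `GL₂` (the only constructible automorphic forms are the `affLogDet` functions of
  `log|det|`, which factor through `det` and are not cuspidal for `n = 2`: the cusp condition
  `CuspConditionGL 2 K φ 1` quantifies over all Haar measures / fundamental domains of
  `N(K)\N(𝔸_K)` and fails for constants).  So no junk / small / degenerate model exists AT ALL:
  `n` and `[E:F]` are pinned, `F = E` is excluded by `finrank F E = 2`, `hF`/`hE` are proofs of a
  TRUE proposition (`isCompact_glFiniteIntegralLevel_holds`), and the only ζ with
  `IsPrimitiveRoot ζ 2` is `-1` (§3).  Even hypothetically leaked one-dimensional junk
  (characters `χ ∘ det`) would satisfy all four clauses (`BC(χ∘det) = (χ∘N)∘det`, Satake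
  `{χ(ϖ)q^{1/2}, χ(ϖ)q^{-1/2}} ↦ its f-th power`), so it could not kill either.
* §3 LOAD-BEARING HYPOTHESES.
  - (a)'s inert witness `∀ ζ, IsPrimitiveRoot ζ 2 → α.map (ζ * ·) ≠ α` is EXACTLY "trace ≠ 0":
    `inertWitness_of_sum_ne_zero` (any `α`: `α.sum ≠ 0` suffices — the form provers of E1″ need:
    `a_p(f) ≠ 0` at one prime `p` inert in `K`) and the TIGHTNESS converse
    `etaSymmetric_of_sum_eq_zero` (`card α = 2`, `α.sum = 0 ⇒ α = -α`): at a trace-zero inert place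
    the unramified datum cannot separate `π` from `π ⊗ η_{E/F}`, so the hypothesis cannot be
    weakened place-wise; `inertWitness_iff_sum_ne_zero` packages both.
  - DROPPING the witness (clause (a) for every cuspidal `π`, `ClauseAWithoutInertWitness`) is FALSE
    in print — `π = AI_E^F(θ)` has `BC_E(π) = θ ⊞ θ^σ` Eisenstein (A–C III.4.2 (b)), and a cuspidal
    weak lift would be nearly equivalent to it, contradicting Jacquet–Shalika 1981 Thm 4.4 — but by
    §2-type reasoning it is NOT refutable here (needs a dihedral cusp form): recorded as
    `clauseAWithoutInertWitness_false_of`, the kernel-checked reduction of its falsity to the one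
    object a disprover must supply (a cuspidal `π` on `GL₂(𝔸_F)` with no cuspidal weak lift).
  - DROPPING the guard `Algebra.IsUnramifiedIn (𝓞 E) v` in (b)(ii) (descent of unramifiedness) is
    FALSE in print at a ramified `v` (A–C I Prop. 6.7: `π_v = π(η_v, 1)` is ramified while
    `BC(π_v) = π(1,1)` is unramified) — same status, `ClauseBDescentWithoutGuard`, doc only.
  - `[IsGalois F E]` is REDUNDANT given `finrank F E = 2` in characteristic `0`
    (`isGalois_of_finrank_eq_two`): mutation finding, harmless ("hypothesis unnecessary").
  - Clause (b)(i) is REDUNDANT given clause (c) (`isUnramifiedBaseChangeLift_of_allFinite`):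
    (c) is (b)(i) without the unramified-in-`E` guard.  So the crux is equivalent to
    (a) ∧ (b)(ii) ∧ (c) ∧ (d) (`quadraticBaseChangeGL2_iff_slim`).
* §4 PAPER DRIFT AUDIT (docstrings of §3; no Lean object exists to test against): (a) one inert
  unramified `v` with `{a,b} ≠ {-a,-b}` ⇒ `π_v ≇ π_v ⊗ η_v` ⇒ `π ≇ π ⊗ η` ⇒ `BC(π)` cuspidal
  (A–C III.4.2 (a)); (b)(ii) at `v` unramified in `E`, `I_{E_w} = I_{F_v}` so `φ_v|_{W_E × SL₂}`
  unramified ⇒ `φ_v` unramified; (c) at `v` ramified in `E`, `π_v = π(χ₁,χ₂)` unramified ⇒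
  `BC(π_v) = π(χ₁∘N, χ₂∘N)` unramified with Satake `χ_i(N ϖ_w) = χ_i(ϖ_v) = α` (`f = 1`), at inert
  `v` `α²` (`q_w = q_v²` matches the `q^{i(n-i)/2}` normalisation of `HasSatakeParamAt`); (d) at a
  real `v` of `F` complex in `E`: `φ_v|_{ℂ^×} = ⊕ z^{μ_i} z̄^{ν_i}` with `{μ_i} = {ν_i}` (stability
  under `j`), so the Harish-Chandra parameter of `BC(π_v)` on both copies of `𝔤𝔩₂(ℂ)_ℂ` is the
  infinitesimal character of `π_v` — exactly `τ ↦ χ(τ|_F)` for both `τ, τ̄` over `σ`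
  (`ArchimedeanGLn.HasArchParameter`: real place ↦ HC parameter `χ σ_w`; complex place ↦
  `(χ σ_w, χ σ̄_w)`); split `v` (real or complex): `P_{w_i} ≅ π_v` through the `F_v`-algebra
  identification `E_{w_i} = F_v`, i.e. `τ_i|_F = σ`.  No drift found.
* Barriers catalogue (`Literature/Barriers/Langlands/*`): none concerns base change for `GL₂`
  (theorem in print); negatives index (`ledger negatives --problem Langlands`, 3 entries): none
  applies (the `n = 0` junk of stmt-17212 is excluded here, `n = 2` pinned).

LANDED (Negative lane, `--supports stmt-Langlands-16812`, both ACCEPTED 2026-08-17):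
`Theorems/QuadraticBaseChangeGL2/Negative/RefutationNeedsCuspForm.lean` (p143013: §1 + §2, proofs
inlined so that no declaration concludes the crux) and
`Theorems/QuadraticBaseChangeGL2/Negative/InertWitnessTrace.lean` (p143301: §3a).  The copy of the
crux in `Theses/RuelleTorsionArtinWeight.lean` (same item, rank 8 there) is textually identical
(checked by diff), so everything here applies to it verbatim.

No `sorry` in this file.  Re-arm instructions (HANDOFF): if a later tree constructs cusp forms on
`GL₂` (theta series / `AI(θ)`), revisit §3 (the two "false in print" weakenings become landable
`_false_without_` lemmas) — the crux itself stays a theorem in print.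
-/

set_option linter.dupNamespace false

noncomputable section

open scoped NumberField Classical
open NumberField IsDedekindDomain
open Literature.NumberTheory.Automorphic
open Summit.Langlands.Langlands.Theses.ParityBlindBianchi

namespace Summit.Langlands.Langlands.Cruxes.QuadraticBaseChangeGL2.Disproof

/-! ## §0  The four clauses by name (the crux is their conjunction, `Iff.rfl`) -/

/-- Clause (a) of the crux: cuspidal weak base change for `GL₂` along a quadratic `E/F`, given ONE
inert place with a non-`η`-symmetric Satake parameter (A–C III.4.2 (a) at `n = 2`).
[cite: ArthurClozelAMS120, Ch. 3 Thm 4.2 (a)] -/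
def ClauseA : Prop :=
  ∀ (F E : Type) [Field F] [NumberField F] [Field E] [NumberField E] [Algebra F E] [IsGalois F E],
    Module.finrank F E = 2 →
      ∀ (hF : isCompact_glFiniteIntegralLevel 2 F) (π : CuspidalAutomorphicRepData 2 F hF),
        (∃ (v : HeightOneSpectrum (𝓞 F)) (w : HeightOneSpectrum (𝓞 E)) (α : Multiset ℂ),
            w.asIdeal.under (𝓞 F) = v.asIdeal ∧
              w.asIdeal.inertiaDeg (𝓞 F) = Module.finrank F E ∧ π.1.HasSatakeParamAt v α ∧
                ∀ ζ : ℂ, IsPrimitiveRoot ζ (Module.finrank F E) → α.map (ζ * ·) ≠ α) →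
          ∀ (hE : isCompact_glFiniteIntegralLevel 2 E),
            ∃ P : CuspidalAutomorphicRepData 2 E hE, IsWeakBaseChangeLiftAE π.1 P.1

/-- Clause (b) of the crux: a cuspidal weak lift is an unramified strong lift, and unramifiedness
descends at places unramified in `E` (A–C III.5.1 + I §6 at `n = 2`).
[cite: ArthurClozelAMS120, Ch. 3 Thm 5.1] -/
def ClauseB : Prop :=
  ∀ (F E : Type) [Field F] [NumberField F] [Field E] [NumberField E] [Algebra F E] [IsGalois F E],
    Module.finrank F E = 2 →
      ∀ (hF : isCompact_glFiniteIntegralLevel 2 F) (hE : isCompact_glFiniteIntegralLevel 2 E)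
        (π : CuspidalAutomorphicRepData 2 F hF) (P : CuspidalAutomorphicRepData 2 E hE),
        IsWeakBaseChangeLiftAE π.1 P.1 →
          IsUnramifiedBaseChangeLift π.1 P.1 ∧
            ∀ v : HeightOneSpectrum (𝓞 F), Algebra.IsUnramifiedIn (𝓞 E) v.asIdeal →
              (∀ w : HeightOneSpectrum (𝓞 E), w.asIdeal.under (𝓞 F) = v.asIdeal →
                  P.1.IsUnramifiedAt w) → π.1.IsUnramifiedAt v

/-- Clause (c) of the crux: `t_{P,w} = t_{π,v}^{f(w|v)}` at EVERY finite `w` over a place where `π`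
is unramified, `v` ramified in `E` allowed (A–C III.5.1 at `n = 2`).
[cite: ArthurClozelAMS120, Ch. 3 Thm 5.1] -/
def ClauseC : Prop :=
  ∀ (F E : Type) [Field F] [NumberField F] [Field E] [NumberField E] [Algebra F E] [IsGalois F E],
    Module.finrank F E = 2 →
      ∀ (hF : isCompact_glFiniteIntegralLevel 2 F) (hE : isCompact_glFiniteIntegralLevel 2 E)
        (π : CuspidalAutomorphicRepData 2 F hF) (P : CuspidalAutomorphicRepData 2 E hE),
        IsWeakBaseChangeLiftAE π.1 P.1 →
          ∀ (w : HeightOneSpectrum (𝓞 E)) (v : HeightOneSpectrum (𝓞 F)) (α : Multiset ℂ),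
            w.asIdeal.under (𝓞 F) = v.asIdeal → π.1.HasSatakeParamAt v α →
              P.1.HasSatakeParamAt w (α.map (· ^ w.asIdeal.inertiaDeg (𝓞 F)))

/-- Clause (d) of the crux: archimedean parameters restrict along a cuspidal weak lift,
`χ_P(τ) = χ_π(τ|_F)` (A–C III.5.1 + I §7 at `n = 2`). [cite: ArthurClozelAMS120, Ch. 3 Thm 5.1] -/
def ClauseD : Prop :=
  ∀ (F E : Type) [Field F] [NumberField F] [Field E] [NumberField E] [Algebra F E] [IsGalois F E],
    Module.finrank F E = 2 →
      ∀ (hF : isCompact_glFiniteIntegralLevel 2 F) (hE : isCompact_glFiniteIntegralLevel 2 E)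
        (π : CuspidalAutomorphicRepData 2 F hF) (P : CuspidalAutomorphicRepData 2 E hE),
        IsWeakBaseChangeLiftAE π.1 P.1 →
          ∀ χ : (F →+* ℂ) → Multiset ℂ, π.1.HasArchParameter χ →
            P.1.HasArchParameter fun τ => χ (τ.comp (algebraMap F E))

/-- The crux IS the conjunction of the four named clauses (definitional). [folklore] -/
theorem quadraticBaseChangeGL2_iff_clauses :
    QuadraticBaseChangeGL2 ↔ ClauseA ∧ ClauseB ∧ ClauseC ∧ ClauseD :=
  Iff.rfl

/-! ## §1  The crux is the verbatim `n = 2` specialisation of four vendored facts -/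

/-- `[E : F] = 2` is a prime degree. [folklore] -/
theorem prime_finrank_of_eq_two {F E : Type*} [Field F] [Field E] [Algebra F E]
    (h2 : Module.finrank F E = 2) : (Module.finrank F E).Prime := by
  rw [h2]; exact Nat.prime_two

/-- A Galois extension of degree `2` has cyclic Galois group (order `2`). [folklore] -/
theorem isCyclic_aut_of_finrank_eq_two {F E : Type*} [Field F] [Field E] [Algebra F E]
    [IsGalois F E] (h2 : Module.finrank F E = 2) : IsCyclic (E ≃ₐ[F] E) :=
  haveI : FiniteDimensional F E := Module.finite_of_finrank_eq_succ h2
  isCyclic_of_prime_card (p := Module.finrank F E) (hp := ⟨prime_finrank_of_eq_two h2⟩)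
    (IsGalois.card_aut_eq_finrank F E)

/-- **The crux follows from the four vendored base-change facts at `n = 2`** (Arthur–Clozel 1989,
Ch. 3 Thm 4.2 (a) and Thm 5.1 with Ch. 1 §6–7; Langlands 1980): clause by clause, with
`(Module.finrank F E).Prime` from `finrank = 2` and, for (d), cyclicity of the order-two Galois
group.  (Positive; recorded here only as the engine of the negative reading
`not_facts_of_not_quadraticBaseChangeGL2` — a prover lands the positive form.)
[cite: ArthurClozelAMS120, Ch. 3 Thm 4.2 (a), Thm 5.1] -/
theorem quadraticBaseChangeGL2_of_facts (ha : baseChange_cyclic_cuspidal)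
    (hb : ArthurClozel1989_strongLifting_unramified) (hc : ArthurClozel1989_strongLifting_allFinite)
    (hd : ArthurClozel1989_strongLifting_archimedean) : QuadraticBaseChangeGL2 := by
  refine ⟨?_, ?_, ?_, ?_⟩
  · intro F E _ _ _ _ _ _ h2 hF π hw hE
    exact ha 2 F E (prime_finrank_of_eq_two h2) hF π hw hE
  · intro F E _ _ _ _ _ _ h2 hF hE π P hlift
    exact hb 2 F E (prime_finrank_of_eq_two h2) hF hE π P hlift
  · intro F E _ _ _ _ _ _ h2 hF hE π P hlift
    exact hc 2 F E (prime_finrank_of_eq_two h2) hF hE π P hlift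
  · intro F E _ _ _ _ _ _ h2 hF hE π P hlift
    exact hd 2 F E hF hE (isCyclic_aut_of_finrank_eq_two h2) (prime_finrank_of_eq_two h2) π P hlift

/-- **Negative reading: a refutation of the crux refutes printed theorems.**  `¬ QuadraticBaseChangeGL2`
implies the negation of the conjunction of the four vendored Literature facts (each the statement of
a theorem in print: A–C III.4.2 (a), III.5.1 + I §6, I §7).  So the only way the crux can be false
is vocabulary drift inside the datum model shared with those facts.
[cite: ArthurClozelAMS120, Ch. 3 Thm 4.2 (a), Thm 5.1] -/
theorem not_facts_of_not_quadraticBaseChangeGL2 (hn : ¬ QuadraticBaseChangeGL2) :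
    ¬ (baseChange_cyclic_cuspidal ∧ ArthurClozel1989_strongLifting_unramified ∧
        ArthurClozel1989_strongLifting_allFinite ∧ ArthurClozel1989_strongLifting_archimedean) :=
  fun h => hn (quadraticBaseChangeGL2_of_facts h.1 h.2.1 h.2.2.1 h.2.2.2)

/-! ## §2  Refutation barrier: any disproof inhabits `CuspidalAutomorphicRepData 2` -/

/-- If NO cuspidal automorphic representation datum of `GL₂` exists over any number field, the crux
holds vacuously: every clause is a `∀ π : CuspidalAutomorphicRepData 2 F hF, …`.  (Positive but
vacuous; the engine of `exists_cuspidal_of_not_quadraticBaseChangeGL2`.) [folklore] -/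
theorem quadraticBaseChangeGL2_of_isEmpty
    (h : ∀ (F : Type) [Field F] [NumberField F] (hF : isCompact_glFiniteIntegralLevel 2 F),
      IsEmpty (CuspidalAutomorphicRepData 2 F hF)) :
    QuadraticBaseChangeGL2 := by
  refine ⟨?_, ?_, ?_, ?_⟩
  · intro F E _ _ _ _ _ _ _ hF π
    exact (h F hF).elim π
  · intro F E _ _ _ _ _ _ _ hF hE π
    exact (h F hF).elim π
  · intro F E _ _ _ _ _ _ _ hF hE π
    exact (h F hF).elim π
  · intro F E _ _ _ _ _ _ _ hF hE π
    exact (h F hF).elim π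

/-- **Refutation barrier.**  Any proof of `¬ QuadraticBaseChangeGL2` yields a number field `F` and
an inhabitant of `CuspidalAutomorphicRepData 2 F hF` — i.e. proves an instance of the undischarged
inhabitation fact `nonempty_cuspidalAutomorphicRepData_two` (Gelbart 1975, Thm 7.11).  The tree
constructs no cusp form on `GL₂` (its only explicit automorphic forms factor through `det`), so no
unconditional refutation — in particular no junk-model, small-model or degenerate-parameter kill —
is available: the disprover's verdict "resists" is forced, not merely empirical.
[cite: Gelbart1975, Thm. 7.11] -/
theorem exists_cuspidal_of_not_quadraticBaseChangeGL2 (hn : ¬ QuadraticBaseChangeGL2) :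
    ∃ (F : Type) (_ : Field F) (_ : NumberField F) (hF : isCompact_glFiniteIntegralLevel 2 F),
      Nonempty (CuspidalAutomorphicRepData 2 F hF) := by
  by_contra hne
  push Not at hne
  exact hn (quadraticBaseChangeGL2_of_isEmpty fun F _ _ hF => hne F _ _ hF)

/-- Sharper form for clause (a): a refutation of clause (a) ALONE yields a quadratic extension
`E/F`, a cuspidal `π` on `GL₂(𝔸_F)` carrying the inert witness, and (for some `hE`) the
non-existence of any cuspidal weak lift — precisely a counterexample to Langlands' base change for
`GL(2)` (A–C III.4.2 (a)). [cite: ArthurClozelAMS120, Ch. 3 Thm 4.2 (a)] -/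
theorem clauseA_counterexample_shape (hn : ¬ ClauseA) :
    ∃ (F E : Type) (_ : Field F) (_ : NumberField F) (_ : Field E) (_ : NumberField E)
      (_ : Algebra F E) (_ : IsGalois F E) (_ : Module.finrank F E = 2)
      (hF : isCompact_glFiniteIntegralLevel 2 F) (π : CuspidalAutomorphicRepData 2 F hF)
      (hE : isCompact_glFiniteIntegralLevel 2 E),
      (∃ (v : HeightOneSpectrum (𝓞 F)) (w : HeightOneSpectrum (𝓞 E)) (α : Multiset ℂ),
          w.asIdeal.under (𝓞 F) = v.asIdeal ∧
            w.asIdeal.inertiaDeg (𝓞 F) = Module.finrank F E ∧ π.1.HasSatakeParamAt v α ∧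
              ∀ ζ : ℂ, IsPrimitiveRoot ζ (Module.finrank F E) → α.map (ζ * ·) ≠ α) ∧
        ∀ P : CuspidalAutomorphicRepData 2 E hE, ¬ IsWeakBaseChangeLiftAE π.1 P.1 := by
  by_contra hne
  push Not at hne
  refine hn ?_
  intro F E _ _ _ _ _ _ h2 hF π hw hE
  exact hne F E _ _ _ _ _ ‹_› h2 hF π hE hw

/-! ## §3  Load-bearing hypotheses -/

/-! ### §3a  The inert witness is exactly "trace ≠ 0" (usable direction + tightness) -/

/-- In a domain of characteristic `≠ 2` such as `ℂ`, the primitive square roots of unity are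
exactly `-1`: the quantifier `∀ ζ, IsPrimitiveRoot ζ 2 → …` of clause (a) hides no vacuity and no
extra generality. [folklore] -/
theorem isPrimitiveRoot_two_iff (ζ : ℂ) : IsPrimitiveRoot ζ 2 ↔ ζ = -1 := by
  refine ⟨fun h => h.eq_neg_one_of_two_right, ?_⟩
  rintro rfl
  exact IsPrimitiveRoot.neg_one 0 (by norm_num)

/-- `α.map ((-1) * ·)` has sum `-α.sum`. [folklore] -/
theorem sum_map_neg_one_mul (α : Multiset ℂ) : (α.map ((-1 : ℂ) * ·)).sum = -α.sum := by
  rw [Multiset.sum_map_mul_left, Multiset.map_id']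
  ring

/-- **Usable direction (any multiset): non-zero trace is an inert witness.**  If `α.sum ≠ 0` then
`α` is not `η`-symmetric, `α ≠ -α` as multisets; so the hypothesis of clause (a) is met by ONE
place `v` inert in `E` where `π_v` is unramified with Hecke eigenvalue `a_v = q_v^{1/2} α.sum ≠ 0`
(for `π_f`, `f` a newform: `a_p(f) ≠ 0` at one prime `p` inert in `K`). [folklore] -/
theorem inertWitness_of_sum_ne_zero {α : Multiset ℂ} (hα : α.sum ≠ 0) :
    ∀ ζ : ℂ, IsPrimitiveRoot ζ 2 → α.map (ζ * ·) ≠ α := by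
  intro ζ hζ heq
  rw [(isPrimitiveRoot_two_iff ζ).1 hζ] at heq
  have hs := congrArg Multiset.sum heq
  rw [sum_map_neg_one_mul] at hs
  apply hα
  linear_combination (-(1 : ℂ) / 2) * hs

/-- **Tightness (rank 2): zero trace kills the witness.**  If `card α = 2` and `α.sum = 0` then
`α = {a, -a}` IS `η`-symmetric: `α.map ((-1) * ·) = α`.  At such an inert place the unramified
datum of `π` coincides with that of `π ⊗ η_{E/F}`, so no place-wise weakening of the witness can
force `π ≇ π ⊗ η` (the load-bearing role of the hypothesis in A–C III.4.2 (a)). [folklore] -/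
theorem etaSymmetric_of_sum_eq_zero {α : Multiset ℂ} (h2 : Multiset.card α = 2)
    (h0 : α.sum = 0) : α.map ((-1 : ℂ) * ·) = α := by
  obtain ⟨a, b, rfl⟩ := Multiset.card_eq_two.1 h2
  have hb : b = -a := by
    simp only [Multiset.insert_eq_cons, Multiset.sum_cons, Multiset.sum_singleton] at h0
    linear_combination h0
  subst hb
  simp only [Multiset.insert_eq_cons, Multiset.map_cons, Multiset.map_singleton, neg_mul, one_mul,
    neg_neg]
  exact Multiset.pair_comm (-a) a

/-- **The inert witness of clause (a) is exactly `trace ≠ 0`** for a rank-two Satake parameter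
(`card α = 2`, as every `HasSatakeParamAt` datum has, `HasSatakeParamAt.card_eq`). [folklore] -/
theorem inertWitness_iff_sum_ne_zero {α : Multiset ℂ} (h2 : Multiset.card α = 2) :
    (∀ ζ : ℂ, IsPrimitiveRoot ζ 2 → α.map (ζ * ·) ≠ α) ↔ α.sum ≠ 0 := by
  refine ⟨fun h h0 => ?_, inertWitness_of_sum_ne_zero⟩
  exact h (-1) ((isPrimitiveRoot_two_iff _).2 rfl) (etaSymmetric_of_sum_eq_zero h2 h0)

/-- The witness clause of (a), read through `finrank F E = 2`, in the trace form consumers use.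
[folklore] -/
theorem inertWitness_iff_sum_ne_zero' {F E : Type*} [Field F] [Field E] [Algebra F E]
    (hFE : Module.finrank F E = 2) {α : Multiset ℂ} (h2 : Multiset.card α = 2) :
    (∀ ζ : ℂ, IsPrimitiveRoot ζ (Module.finrank F E) → α.map (ζ * ·) ≠ α) ↔ α.sum ≠ 0 := by
  rw [hFE]; exact inertWitness_iff_sum_ne_zero h2

/-! ### §3b  Dropping the inert witness: false in print, not refutable here -/

/-- **Clause (a) WITHOUT the inert witness** — "every cuspidal `π` on `GL₂(𝔸_F)` has a cuspidal
weak base-change lift to every quadratic `E`".  FALSE in print: for `π = AI_E^F(θ)` automorphically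
induced from a Hecke character `θ ≠ θ^σ` of `E` (`π ≅ π ⊗ η_{E/F}`), `BC_E(π) = θ ⊞ θ^σ` is
Eisenstein (Arthur–Clozel 1989, Ch. 3 Thm 4.2 (b); Langlands 1980 §2), and a CUSPIDAL weak lift `P`
would be nearly equivalent to it, contradicting Jacquet–Shalika 1981, Thm 4.4.  Not refutable in the
tree (no dihedral cusp form is constructible, §2); see `clauseAWithoutInertWitness_false_of`.
[cite: ArthurClozelAMS120, Ch. 3 Thm 4.2 (b)] -/
def ClauseAWithoutInertWitness : Prop :=
  ∀ (F E : Type) [Field F] [NumberField F] [Field E] [NumberField E] [Algebra F E] [IsGalois F E],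
    Module.finrank F E = 2 →
      ∀ (hF : isCompact_glFiniteIntegralLevel 2 F) (π : CuspidalAutomorphicRepData 2 F hF)
        (hE : isCompact_glFiniteIntegralLevel 2 E),
        ∃ P : CuspidalAutomorphicRepData 2 E hE, IsWeakBaseChangeLiftAE π.1 P.1

/-- The weakened clause implies clause (a) (it simply ignores the witness): the witness is the ONLY
thing separating the crux's clause (a) from a statement that is false in print. [folklore] -/
theorem clauseA_of_withoutInertWitness (h : ClauseAWithoutInertWitness) : ClauseA :=
  fun F E _ _ _ _ _ _ h2 hF π _ hE => h F E h2 hF π hE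

/-- **Load-bearing role of the inert witness, reduced to the one missing object.**  The weakened
clause is false as soon as ONE cuspidal `π` on some `GL₂(𝔸_F)` admits no cuspidal weak lift to some
quadratic `E` — in print, any `π = AI_E^F(θ)`, `θ ≠ θ^σ` (Jacquet–Langlands 1970 §12 for its
cuspidality, A–C III.4.2 (b) + Jacquet–Shalika Thm 4.4 for the non-existence of a cuspidal lift).
The hypothesis is the exact shape a future `_false_without_inertWitness` lemma must construct.
[cite: ArthurClozelAMS120, Ch. 3 Thm 4.2 (b)] [cite: JacquetShalika1981, Thm. 4.4] -/
theorem clauseAWithoutInertWitness_false_of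
    (H : ∃ (F E : Type) (_ : Field F) (_ : NumberField F) (_ : Field E) (_ : NumberField E)
      (_ : Algebra F E) (_ : IsGalois F E) (_ : Module.finrank F E = 2)
      (hF : isCompact_glFiniteIntegralLevel 2 F) (π : CuspidalAutomorphicRepData 2 F hF)
      (hE : isCompact_glFiniteIntegralLevel 2 E),
      ∀ P : CuspidalAutomorphicRepData 2 E hE, ¬ IsWeakBaseChangeLiftAE π.1 P.1) :
    ¬ ClauseAWithoutInertWitness := by
  obtain ⟨F, E, _, _, _, _, _, _, h2, hF, π, hE, hno⟩ := H
  intro h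
  obtain ⟨P, hP⟩ := h F E h2 hF π hE
  exact hno P hP

/-! ### §3c  Dropping the unramified-in-`E` guard of (b)(ii): false in print (doc) -/

/-- **Clause (b)(ii) WITHOUT the guard `Algebra.IsUnramifiedIn (𝓞 E) v`** — descent of
unramifiedness at EVERY finite `v`.  FALSE in print at a place `v` ramified in `E`: the ramified
principal series `π_v = π(η_v, 1)` (`η_v` the local quadratic character of `E_w/F_v`, ramified) has
unramified base change `π(η_v ∘ N, 1) = π(1, 1)` (Arthur–Clozel 1989, Ch. 1 Prop. 6.7: the fibres of
local base change are the twists by characters of `F_v^×/N E_w^×`, unramified EXACTLY when `E_w/F_v`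
is); globally, `π ⊗ χ` with `χ` a Hecke character ramified only at `v` with `χ_v = η_v` there.  Not
refutable in the tree (§2).  The guard is therefore load-bearing and correctly placed.
[cite: ArthurClozelAMS120, Ch. 1 Prop. 6.7] -/
def ClauseBDescentWithoutGuard : Prop :=
  ∀ (F E : Type) [Field F] [NumberField F] [Field E] [NumberField E] [Algebra F E] [IsGalois F E],
    Module.finrank F E = 2 →
      ∀ (hF : isCompact_glFiniteIntegralLevel 2 F) (hE : isCompact_glFiniteIntegralLevel 2 E)
        (π : CuspidalAutomorphicRepData 2 F hF) (P : CuspidalAutomorphicRepData 2 E hE),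
        IsWeakBaseChangeLiftAE π.1 P.1 →
          ∀ v : HeightOneSpectrum (𝓞 F),
            (∀ w : HeightOneSpectrum (𝓞 E), w.asIdeal.under (𝓞 F) = v.asIdeal →
                P.1.IsUnramifiedAt w) → π.1.IsUnramifiedAt v

/-- The unguarded descent implies the guarded clause (b)(ii) (monotonicity), so the guard only
weakens; its removal is what A–C I Prop. 6.7 forbids. [folklore] -/
theorem clauseB2_of_descentWithoutGuard (h : ClauseBDescentWithoutGuard)
    (F E : Type) [Field F] [NumberField F] [Field E] [NumberField E] [Algebra F E] [IsGalois F E]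
    (h2 : Module.finrank F E = 2) (hF : isCompact_glFiniteIntegralLevel 2 F)
    (hE : isCompact_glFiniteIntegralLevel 2 E) (π : CuspidalAutomorphicRepData 2 F hF)
    (P : CuspidalAutomorphicRepData 2 E hE) (hlift : IsWeakBaseChangeLiftAE π.1 P.1)
    (v : HeightOneSpectrum (𝓞 F)) (_hv : Algebra.IsUnramifiedIn (𝓞 E) v.asIdeal)
    (hw : ∀ w : HeightOneSpectrum (𝓞 E), w.asIdeal.under (𝓞 F) = v.asIdeal → P.1.IsUnramifiedAt w) :
    π.1.IsUnramifiedAt v :=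
  h F E h2 hF hE π P hlift v hw

/-! ### §3d  `[IsGalois F E]` is redundant in degree two (mutation: hypothesis unnecessary) -/

/-- A degree-two extension of fields of characteristic zero is Galois (separable since perfect,
normal since the minimal polynomial of a generator is quadratic with a root in `E`; Mathlib
`IsQuadraticExtension.isGalois`).  So the instance binder `[IsGalois F E]` of every clause is implied
by `Module.finrank F E = 2`: dropping it changes nothing. [folklore] -/
theorem isGalois_of_finrank_eq_two (F E : Type*) [Field F] [CharZero F] [Field E] [Algebra F E]
    (h2 : Module.finrank F E = 2) : IsGalois F E := by
  haveI : Algebra.IsQuadraticExtension F E := ⟨h2⟩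
  haveI : FiniteDimensional F E := Module.finite_of_finrank_eq_succ h2
  haveI : Algebra.IsSeparable F E := Algebra.IsSeparable.of_integral F E
  exact Algebra.IsQuadraticExtension.isGalois F E

/-! ### §3e  Clause (b)(i) is redundant given clause (c) -/

/-- The all-finite-places relation (clause (c), no guard) implies the unramified strong-lift
predicate (clause (b)(i), guarded by `Algebra.IsUnramifiedIn`): (b)(i) carries no content beyond
(c). [folklore] -/
theorem isUnramifiedBaseChangeLift_of_allFinite {F E : Type} [Field F] [NumberField F] [Field E]
    [NumberField E] [Algebra F E] {hF : isCompact_glFiniteIntegralLevel 2 F}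
    {hE : isCompact_glFiniteIntegralLevel 2 E} {π : AutomorphicRepData (AutomorphyDatum.gl 2 F hF)}
    {P : AutomorphicRepData (AutomorphyDatum.gl 2 E hE)}
    (hc : ∀ (w : HeightOneSpectrum (𝓞 E)) (v : HeightOneSpectrum (𝓞 F)) (α : Multiset ℂ),
      w.asIdeal.under (𝓞 F) = v.asIdeal → π.HasSatakeParamAt v α →
        P.HasSatakeParamAt w (α.map (· ^ w.asIdeal.inertiaDeg (𝓞 F)))) :
    IsUnramifiedBaseChangeLift π P :=
  fun w v α hwv _ hα => hc w v α hwv hα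

/-- **Slim form of the crux**: (a) ∧ (b)(ii) ∧ (c) ∧ (d) — clause (b)(i) dropped as redundant.
[folklore] -/
def QuadraticBaseChangeGL2Slim : Prop :=
  ClauseA ∧
  (∀ (F E : Type) [Field F] [NumberField F] [Field E] [NumberField E] [Algebra F E] [IsGalois F E],
    Module.finrank F E = 2 →
      ∀ (hF : isCompact_glFiniteIntegralLevel 2 F) (hE : isCompact_glFiniteIntegralLevel 2 E)
        (π : CuspidalAutomorphicRepData 2 F hF) (P : CuspidalAutomorphicRepData 2 E hE),
        IsWeakBaseChangeLiftAE π.1 P.1 →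
          ∀ v : HeightOneSpectrum (𝓞 F), Algebra.IsUnramifiedIn (𝓞 E) v.asIdeal →
            (∀ w : HeightOneSpectrum (𝓞 E), w.asIdeal.under (𝓞 F) = v.asIdeal →
                P.1.IsUnramifiedAt w) → π.1.IsUnramifiedAt v) ∧
  ClauseC ∧ ClauseD

/-- The crux is equivalent to its slim form (pure logic + `isUnramifiedBaseChangeLift_of_allFinite`).
[folklore] -/
theorem quadraticBaseChangeGL2_iff_slim : QuadraticBaseChangeGL2 ↔ QuadraticBaseChangeGL2Slim := by
  constructor
  · rintro ⟨ha, hb, hc, hd⟩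
    exact ⟨ha, fun F E _ _ _ _ _ _ h2 hF hE π P hl => (hb F E h2 hF hE π P hl).2, hc, hd⟩
  · rintro ⟨ha, hb2, hc, hd⟩
    refine ⟨ha, fun F E _ _ _ _ _ _ h2 hF hE π P hl => ⟨?_, hb2 F E h2 hF hE π P hl⟩, hc, hd⟩
    exact isUnramifiedBaseChangeLift_of_allFinite (hc F E h2 hF hE π P hl)

/-! ## §4  Interface sanity: the level-compactness proofs `hF`, `hE` exist (no vacuous ∀) -/

/-- The binders `hF hE : isCompact_glFiniteIntegralLevel 2 _` range over proofs of a TRUE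
proposition (`isCompact_glFiniteIntegralLevel_holds`), so "`∀ hE, ∃ P`" in clause (a) is a genuine
existence claim and none of the four clauses is vacuous through its `h_` binders. [folklore] -/
theorem level_binders_inhabited (F : Type) [Field F] [NumberField F] :
    Nonempty (isCompact_glFiniteIntegralLevel 2 F) :=
  ⟨isCompact_glFiniteIntegralLevel_holds 2 F⟩

end Summit.Langlands.Langlands.Cruxes.QuadraticBaseChangeGL2.Disproof

end
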